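import Summits.BirchSwinnertonDyer.BirchSwinnertonDyer.Theorems.SignedLowerHalvesKobayashiMainConjectureSmallImageLambdaTransferCM
import Summits.BirchSwinnertonDyer.BirchSwinnertonDyer.Theorems.SignedLowerHalvesKobayashiLowerHalfLargeImageCongruencePlaces
import Summits.BirchSwinnertonDyer.BirchSwinnertonDyer.Theorems.SignedLowerHalvesKobayashiLowerHalfLargeImageCongruencePlacesGood
import Summits.BirchSwinnertonDyer.BirchSwinnertonDyer.Theorems.SignedLowerHalvesKobayashiMainConjectureSmallImageCMTransferMuRecords02
import Summits.BirchSwinnertonDyer.BirchSwinnertonDyer.Theorems.SignedLowerHalvesKobayashiMainConjectureSmallImageCMTransferRecordsA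
import Summits.BirchSwinnertonDyer.Rank1Residual.X12.ThreeIrrRecords
import Summits.BirchSwinnertonDyer.BirchSwinnertonDyer.Theorems.SignedLowerHalvesKobayashiMainConjectureSmallImageCM25RecordsA
import HarnessLib

/-!
# Route `SignedLowerHalves`, crux `KobayashiMainConjectureSmallImage` (item stmt-BirchSwinnertonDyer-19002):
# small-image congruence road («L4-λ») — RECORDS «L4LAM-r2» part A: 380894f1 @ 3 (cell `bsd-ssimc`, seat `bsd-ssimc-k3-c4` gen 8; planner D26-6 (a)(ii);
# a `--supports stmt-BirchSwinnertonDyer-19002 --as helper` file; closes nothing about the crux)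

PARTITION (cell bsd-ssimc): X7 (A7) × the pair `380894f1 @ 3` — per-pair records (Kobayashi's signed main conjecture for the listed signs, from
PUBLISHED facts + displayed certificates); the crux `KobayashiMainConjectureSmallImage` stays OPEN; 0 census moves are booked here (desk
keys are the planner's to file); BSD is not proved by any of this. THEOREMS ONLY.

## Provenance (finding «CM-25» of the seat's MEMO-8)

These pairs were booked «no CM elliptic-curve partner» by the seat's gen-0 probe (`cm_congruence_probe.tsv`), which at `p = 3` searched
only the `j = 1728` family; the quadratic field of the normaliser character is in fact a class-number-one field with `p` inert, and the CM
curve of that field (or a quadratic twist) IS `p`-congruent to `E` — here PROVED in the kernel by a Fisher Hesse-pencil identity (`norm_num`;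
certificates found by g5's exact `cert/hesse3_find.py` at `p = 3`, by g0's `hesse.gp` (PARI, kit j268836) at `p = 5`). The records then run
verbatim on g6's road (`…LambdaTransferCM.lean` p473173; template `…LambdaTransferCMRecords01.lean` p474509):
`SmallImageCongruenceRoad.kobayashiMainConjecture_{neg_one,one}_of_cmPartner_of_mazurTate` — partner MC = Pollack–Rubin 2004 BY NAME (`hPR`;
`p` inert in the CM field, checked per pair), Kim 2009 μ- and λ-transfer BY NAME (`h09`, `hKim`), Kobayashi Thm. 1.2 / 4.1-rational (`h12`,
`h41`), period units (`h5`, `h3`), modularity (`hmod`), Pollack (`hPollack`); per pair the DISPLAYED certificate rows (two engines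
agreeing: B = b2b msengine `MSENGINE_SHA256SUMS`, T = iw-2 `engT.py` d8b96ce8, byte-identical re-uses, kit j268836; E-side rows also b2b
`b2b-bsdres-iw-2/tables/engT_layers.tsv` CERTIFIED+AGREE where marked) as `(hΘ, hΘ0, hμ, hlam)` quadruples, and the KERNEL-DECIDED δ-bookkeeping
(`places_<tag>`, toolkit `…LargeImageCongruencePlaces(.Good).lean` p467415). NO `Surj`, NO `BSD(E,p)` input, NO preprint, NO Mazur–Tate
congruence `hMT`.

This part: the OPEN desk cell `380894f1 @ 3` (X7, `r_an = 1`, `∏c = 36`, `#Ш_an = 1`; partner 1849a1; its CM lemma is the landed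
`hasCM_cm25A_cmm43_tw1_p3` of `…CM25RecordsA.lean`, its point count the landed `X12.Records.card_1849a1_mod3`). The rank-1 `BSD(E,3)` consumer
(BKO Cor. A.5 road) is NOT invoked here — whether Cor. A.5's hypotheses are met at (E, 3) is for the planner / desk (seat MEMO-8 §6).

References: [Kobayashi2003] Conj. (p. 2), Thm. 1.2, 4.1; [BDKim2009] Cor. 2.13, 2.5, Prop. 2.6; [PollackRubin2004] Thm. (p. 448);
[Pollack2003] Def. 6.15, Prop. 6.9/6.10/6.18; [Fisher2012Hessian] Thm. 13.2, §13; [GreenbergVatsal2000] Prop. (2.4); [BDKim2013] Cor. 3.15;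
[Cremona2006] Table 1; [SilvermanAEC2009] V §2, VII.5, App. C §11. Memo: `HOME/k3c4-MEMO-8.md`.
-/

set_option autoImplicit false
set_option linter.dupNamespace false
noncomputable section

open scoped Classical MatrixGroups ModularForm BigOperators

open CongruenceSubgroup WeierstrassCurve NumberField IsDedekindDomain Rat.HeightOneSpectrum
  Literature.NumberTheory.EllipticCurves
  Literature.NumberTheory.EllipticCurves.ModularForms
  Literature.NumberTheory.EllipticCurves.Rank1Residual
  Literature.NumberTheory.EllipticCurves.Rank1Residual.Typed
  Literature.NumberTheory.EllipticCurves.Kobayashi2003 ZpExtension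
  Literature.NumberTheory.EllipticCurves.GreenbergVatsal2000
  Literature.NumberTheory.EllipticCurves.BDKim2009
  Literature.NumberTheory.EllipticCurves.Fisher2012
  Literature.NumberTheory.EllipticCurves.Rank1Residual.X11RankOneCertificates
  Literature.NumberTheory.GaloisRepresentations
  Summit.BirchSwinnertonDyer.Rank1Residual.X1.MuLambda
  Summit.BirchSwinnertonDyer.Rank1Residual.Supersingular
  Summit.BirchSwinnertonDyer.Rank1Residual.X2.LocalDeltaCalculus
  Summit.BirchSwinnertonDyer.BirchSwinnertonDyer.Rank1Residual.IntModel
  Summit.BirchSwinnertonDyer.BirchSwinnertonDyer.Rank1Residual.X11RankOne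
  Summit.BirchSwinnertonDyer.Rank1Residual.X11b
  Summit.BirchSwinnertonDyer.Rank1Residual.X9
  Summit.BirchSwinnertonDyer.Rank1Residual.X1
  Summit.BirchSwinnertonDyer.BirchSwinnertonDyer.Theorems.CongruenceRoad

namespace Summit.BirchSwinnertonDyer.BirchSwinnertonDyer.Theorems.SmallImageCongruenceRoad


/-! ### §1 Kernel data of the pair -/

/-- `#{Ẽ(𝔽_3)} = 4` for the Cremona model of `380894f1` = `[1, -1, 1, 341, 113339]` (`a_3 = 0`; kernel count). [cite: SilvermanAEC2009, V §2 (a_p = p + 1 − #Ẽ(𝔽_p))] -/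
theorem card_lam25_380894f1_3 :
    Nat.card (((⟨1, -1, 1, 341, 113339⟩ : WeierstrassCurve ℤ).map
      (Int.castRingHom (ZMod 3))).toAffine.Point) = 4 := by
  rw [@WeierstrassCurve.natCard_point_eq_one_add_card (ZMod 3) (@ZMod.instField 3 ⟨by norm_num⟩) _ _ _
    (by decide +kernel), @card_sol_eq_sum_euler (ZMod 3) (@ZMod.instField 3 ⟨by norm_num⟩) _ _
    (by rw [ZMod.ringChar_zmod_n]; decide), ZMod.card]
  decide +kernel

/-- `#(𝔽_103)`-point count `99` of `[0, 0, 1, -860, 9707]` (the CM partner A of the pair `380894f1 @ 3`; fast count, kernel). [cite: SilvermanAEC2009, V §2] -/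
theorem countPoints_380894f1_3_A_103 : countPoints [0, 0, 1, -860, 9707] 103 = (99 : ℕ) :=
  countPoints_eq_of_fast (by decide +kernel)

/-- **The δ-bookkeeping of `(380894f1, A = cmm43_tw1_p3)` at `3`, KERNEL-DECIDED**: with `Σ₀` the places over `{2, 43, 103}` (away from
`3`, containing every bad place of both curves), `Σ_{Σ₀} δ_E = 1` and `Σ_{Σ₀} δ_A = 3` (ℓ = 2: E split; ℓ = 2: A good2_dvd; ℓ = 43: E additive; ℓ = 43: A additive; ℓ = 103: E split; ℓ = 103: A good_dvd).
[cite: GreenbergVatsal2000, §2 Prop. (2.4) (p. 22)] [cite: SilvermanAEC2009, VII.5 Prop. 5.1] -/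
theorem places_380894f1_3 (W A : WeierstrassCurve ℚ) [W.IsElliptic] [W.IsGloballyMinimal]
    [A.IsElliptic] [A.IsGloballyMinimal]
    (hW : W = ⟨1, -1, 1, 341, 113339⟩) (hA : A = ⟨0, 0, 1, -860, 9707⟩) :
    ∃ S₀ : Finset (HeightOneSpectrum (𝓞 ℚ)), (∀ v ∈ S₀, ((3 : ℕ) : 𝓞 ℚ) ∉ v.asIdeal) ∧
      (∀ v : HeightOneSpectrum (𝓞 ℚ), ¬ W.HasGoodReductionAt v → v ∈ S₀) ∧
      (∀ v : HeightOneSpectrum (𝓞 ℚ), ¬ A.HasGoodReductionAt v → v ∈ S₀) ∧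
      ∑ v ∈ S₀, delta W 3 v = 1 ∧ ∑ v ∈ S₀, delta A 3 v = 3 := by
  have hI : integralModelInt W = ⟨1, -1, 1, 341, 113339⟩ :=
    integralModelInt_eq_of_map_eq _ (by rw [hW]; ext <;> simp [WeierstrassCurve.map])
  have hI' : integralModelInt A = ⟨0, 0, 1, -860, 9707⟩ :=
    integralModelInt_eq_of_map_eq _ (by rw [hA]; ext <;> simp [WeierstrassCurve.map])
  set v2 : HeightOneSpectrum (𝓞 ℚ) := (primesEquiv (R := 𝓞 ℚ)).symm ⟨2, Nat.prime_two⟩ with hv2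
  set v43 : HeightOneSpectrum (𝓞 ℚ) := (primesEquiv (R := 𝓞 ℚ)).symm ⟨43, by norm_num⟩ with hv43
  set v103 : HeightOneSpectrum (𝓞 ℚ) := (primesEquiv (R := 𝓞 ℚ)).symm ⟨103, by norm_num⟩ with hv103
  have d2 : delta W 3 v2 = 0 := by
    rw [delta_eq_of_split hI 3 v2 2 (by norm_num) (by rw [hv2, natGenerator_symm]) (by decide) (by decide)
      ⟨0, by decide +kernel⟩, sFactor_eq_of_eq_pow_mul (k := 0) (m := 1) (by norm_num) (by norm_num)]
    decide
  have d43 : delta W 3 v43 = 0 :=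
    delta_eq_zero_of_dvd_of_dvd hI 3 v43 (by rw [hv43, natGenerator_symm]; decide)
      (by rw [hv43, natGenerator_symm]; decide)
  have d103 : delta W 3 v103 = 1 := by
    rw [delta_eq_of_split hI 3 v103 103 (by norm_num) (by rw [hv103, natGenerator_symm]) (by decide) (by decide)
      ⟨24, by decide +kernel⟩, sFactor_eq_of_eq_pow_mul (k := 0) (m := 3536) (by norm_num) (by norm_num)]
    decide
  have e2 : delta A 3 v2 = 1 := by
    have hcard : Nat.card (((⟨0, 0, 1, -860, 9707⟩ : WeierstrassCurve ℤ).map (Int.castRingHom (ZMod 2))).toAffine.Point) = 3 := by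
      rw [WeierstrassCurve.natCard_point_eq_one_add_card _ (by decide +kernel)]
      decide +kernel
    have hgood : A.HasGoodReductionAt v2 :=
      hasGoodReductionAt_of_not_dvd hI' v2 (by rw [hv2, natGenerator_symm]; decide)
    have hgen : natGenerator v2 = 2 := by rw [hv2, natGenerator_symm]
    have ha : A.frobeniusTraceAt v2 = ((2 : ℕ) : ℤ) + 1 - 3 := by
      rw [WeierstrassCurve.frobeniusTraceAt_eq_frobeniusTrace, hv2, primesEquiv_symm]
      exact frobeniusTrace_eq hI' hcard
    have hs : sFactor 3 2 = 1 := by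
      rw [sFactor_eq_of_eq_pow_mul (k := 0) (m := 1) (by norm_num) (by norm_num)]; norm_num
    rw [delta_eq, dMultiplicity_of_hasGoodReductionAt_of_dvd hgood (by rw [hgen]; decide) (by rw [hgen, ha]; decide),
      hgen, hs]
    decide
  have e43 : delta A 3 v43 = 0 :=
    delta_eq_zero_of_dvd_of_dvd hI' 3 v43 (by rw [hv43, natGenerator_symm]; decide)
      (by rw [hv43, natGenerator_symm]; decide)
  have e103 : delta A 3 v103 = 2 := by
    rw [delta_eq_of_good_of_dvd_count hI' 3 v103 103 (by norm_num) (by rw [hv103, natGenerator_symm]) (by norm_num)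
      (by norm_num) rfl (by decide) countPoints_380894f1_3_A_103 (by decide),
      sFactor_eq_of_eq_pow_mul (k := 0) (m := 3536) (by norm_num) (by norm_num)]
    decide
  have n1 : v2 ∉ ({v43, v103} : Finset (HeightOneSpectrum (𝓞 ℚ))) := by
    simp only [Finset.mem_insert, Finset.mem_singleton, hv2, hv43, hv103, not_or]
    exact ⟨symm_ne_symm _ _ (by norm_num), symm_ne_symm _ _ (by norm_num)⟩
  have n2 : v43 ∉ ({v103} : Finset (HeightOneSpectrum (𝓞 ℚ))) := by
    simp only [Finset.mem_singleton, hv43, hv103]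
    exact symm_ne_symm _ _ (by norm_num)
  refine ⟨{v2, v43, v103}, ?_, ?_, ?_, ?_, ?_⟩
  · intro v hv
    simp only [Finset.mem_insert, Finset.mem_singleton] at hv
    rcases hv with rfl | rfl | rfl
    · exact natCast_not_mem_symm (by norm_num) _ (by norm_num)
    · exact natCast_not_mem_symm (by norm_num) _ (by norm_num)
    · exact natCast_not_mem_symm (by norm_num) _ (by norm_num)
  · -- `Σ₀ ⊇` bad places of `E`: `Δ(E) = -(2 ^ 6 * 43 ^ 3 * 103 ^ 3)`
    intro v hv
    by_contra hvS
    apply hv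
    apply hasGoodReductionAt_of_not_dvd hI
    intro hdvd
    have hΔ : (⟨1, -1, 1, 341, 113339⟩ : WeierstrassCurve ℤ).Δ = -(2 ^ 6 * 43 ^ 3 * 103 ^ 3) := by
      decide
    rw [hΔ, dvd_neg] at hdvd
    have hpr := prime_natGenerator v
    have h' : natGenerator v ∣ 2 ^ 6 * 43 ^ 3 * 103 ^ 3 := by exact_mod_cast hdvd
    have key : natGenerator v = 2 ∨ natGenerator v = 43 ∨ natGenerator v = 103 := by
      rcases (Nat.Prime.dvd_mul hpr).mp h' with h | h
      · rcases (Nat.Prime.dvd_mul hpr).mp h with h | h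
        · exact Or.inl ((Nat.prime_dvd_prime_iff_eq hpr Nat.prime_two).mp (hpr.dvd_of_dvd_pow h))
        · exact Or.inr (Or.inl ((Nat.prime_dvd_prime_iff_eq hpr (by norm_num)).mp (hpr.dvd_of_dvd_pow h)))
      · exact Or.inr (Or.inr ((Nat.prime_dvd_prime_iff_eq hpr (by norm_num)).mp (hpr.dvd_of_dvd_pow h)))
    apply hvS
    simp only [Finset.mem_insert, Finset.mem_singleton]
    rcases key with h | h | h
    · exact Or.inl (eq_symm_of_natGenerator_eq Nat.prime_two h)
    · exact Or.inr (Or.inl (eq_symm_of_natGenerator_eq (by norm_num) h))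
    · exact Or.inr (Or.inr (eq_symm_of_natGenerator_eq (by norm_num) h))
  · -- `Σ₀ ⊇` bad places of `A`: `Δ(A) = -(43 ^ 3)`
    intro v hv
    by_contra hvS
    apply hv
    apply hasGoodReductionAt_of_not_dvd hI'
    intro hdvd
    have hΔ : (⟨0, 0, 1, -860, 9707⟩ : WeierstrassCurve ℤ).Δ = -(43 ^ 3) := by
      decide
    rw [hΔ, dvd_neg] at hdvd
    have hpr := prime_natGenerator v
    have h' : natGenerator v ∣ 43 ^ 3 := by exact_mod_cast hdvd
    have key : natGenerator v = 43 := by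
      exact (Nat.prime_dvd_prime_iff_eq hpr (by norm_num)).mp (hpr.dvd_of_dvd_pow h')
    apply hvS
    simp only [Finset.mem_insert, Finset.mem_singleton]
    exact Or.inr (Or.inl (eq_symm_of_natGenerator_eq (by norm_num) key))
  · norm_num [Finset.sum_insert n1, Finset.sum_insert n2, Finset.sum_singleton, d2, d43, d103]
  · norm_num [Finset.sum_insert n1, Finset.sum_insert n2, Finset.sum_singleton, e2, e43, e103]

/-! ### §2 The records: both signs -/

/-- **`lam4_380894f1_3` — Kobayashi's main conjecture for `(380894f1, 3, ε)`, EITHER sign, AT THE PAIR by the small-image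
congruence road with the CM partner `A = 1849a1` = `[0, 0, 1, -860, 9707]` (Cremona `1849a1`: CM by `ℤ[(1+√−43)/2]`, `3` inert in `ℚ(√−43)`, `r_an(A) = 1`) — NO preprint, NO `Surj`, NO `BSD(E,3)` input, NO Mazur–Tate
congruence `hMT`.** Desk cell (referee A's live state `scratchA_A_state_after_addord3_fold.pkl` sha16 1edf686acdce8117): `residue; [(3,'X7')]` (OPEN). Certificates DISPLAYED as
hypotheses (kit j268836, engines byte-identical re-uses: B = b2b msengine `MSENGINE_SHA256SUMS`, T = iw-2 `engT.py` d8b96ce8, A = PARI `ellpadiclambdamu` via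
`engineA.py` a8b8e893; E-side rows also b2b `tables/engT_layers.tsv` where marked): ε = -1: E row θ_3 (λ = deg ω_3^+ + 3), A row θ_1 (λ = deg + 1); ε = 1: E row θ_2 (λ = deg ω_2^− + 3), A row θ_2 (λ = deg + 1). E rows = b2b `b2b-bsdres-iw-2/tables/engT_layers.tsv` 380894f1@3: θ₂ (even, ε = +1) λ = 5 = deg ω₂⁻ + 3 and θ₃ (odd, ε = −1) λ = 9 = deg ω₃⁺ + 3, engine T CERTIFIED and engine B AGREE (iw-2 census rows, quoted, not re-run); partner rows (kit j268836, key `cmm43_tw1_p3`): θ₁ λ = 1 = deg ω₁⁺ + 1 and θ₂ λ = 3 = deg ω₂⁻ + 1 — engine T CERTIFIED V = 1 / V = 3 with exact `msfromell` match, engine B (msengine) (μ, λ) = (0, 1) / (0, 3), engine A `ellpadiclambdamu` = [[1, 1], [0, 0]]. The `3`-congruence is KERNEL-CHECKED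
(`E` ≅ the member (208 : 1) of the Hesse pencil X_A(3) of the MINIMAL model of 1849a1, u = 4, `threeCongruent_of_hesseCertificate_unconditional`, `norm_num`); the δ-bookkeeping `l_E + 1 = l_A + 3` is `places_380894f1_3` (kernel); `a_3 = 0` for both curves and the CM of `A` are
decided in the kernel. Published inputs BY NAME (`h12 h41 h5 h3 h09 hKim hPR hmod hPollack`). PER PAIR; crux 4 stays OPEN; nothing booked;
BSD is not proved by any of this.
[cite: Kobayashi2003, Conjecture (p. 2), Thm. 1.2 and Thm. 4.1] [cite: BDKim2009, Cor. 2.13, Cor. 2.5 and Prop. 2.6 (pp. 185–187)]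
[cite: PollackRubin2004, Theorem (p. 448) = Thm. 7.3] [cite: Pollack2003, Def. 6.15, Prop. 6.9, 6.10 and 6.18]
[cite: Fisher2012Hessian, Thm. 13.2 and §13] [cite: GreenbergVatsal2000, §2 Prop. (2.4)] [cite: Cremona2006, Table 1 (Cremona label 380894f1)] -/
theorem lam4_kobayashiMainConjecture_380894f1_3
    (h12 : Kobayashi2003.thm12_signedSelmerDual_finite_torsion)
    (h41 : Kobayashi2003.thm41_signedCharIdeal_divisibility)
    (h5 : realPeriodRat_eq_unit_mul_plusPeriod) (h3 : realPeriodRat_eq_unit_mul_plusPeriod_three)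
    (h09 : cor213_signedMu_eq_zero_iff_of_torsionIso)
    (hKim : BDKim2009.cor213_signedLambda_add_sum_delta_eq_of_torsionIso)
    (hPR : PollackRubin2004.mainTheorem_signedCharIdeal_eq_of_cm)
    (hmod : nonempty_modularParametrizationData)
    (W A : WeierstrassCurve ℚ) [W.IsElliptic] [W.IsGloballyMinimal] [A.IsElliptic] [A.IsGloballyMinimal]
    [Fact (Nat.Prime 3)] (hW : W = ⟨1, -1, 1, 341, 113339⟩) (hA : A = ⟨0, 0, 1, -860, 9707⟩)
    (hPollack : ∀ {N : ℕ} [NeZero N] {f : CuspForm (Gamma0 N) 2},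
      pollack_exists_plusMinusPAdicLFunction (W := A) (f := f) (p := 3))
    [NeZero (W.conductorNorm ℤ)] {f₀ : CuspForm (Gamma0 (W.conductorNorm ℤ)) 2} (hf₀ : IsNewformOf W f₀)
    [NeZero (A.conductorNorm ℤ)] {f₀' : CuspForm (Gamma0 (A.conductorNorm ℤ)) 2} (hf₀' : IsNewformOf A f₀')
    (ε : ℤˣ) {Θ Θ' : IwasawaAlgebra 3} (hΘ0 : Θ ≠ 0) (hμ : mu Θ = 0) (hΘ'0 : Θ' ≠ 0) (hμ' : mu Θ' = 0)
    (hrow : (ε = -1 ∧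
        iwasawaToPowerSeries 3 Θ = ((mazurTateElement f₀ 3 3).map (algebraMap ℚ ℚ_[3]) : PowerSeries ℚ_[3]) ∧
        lam Θ = (cyclotomicOmegaPlus 3 3).natDegree + 3 ∧
        iwasawaToPowerSeries 3 Θ' = ((mazurTateElement f₀' 3 1).map (algebraMap ℚ ℚ_[3]) : PowerSeries ℚ_[3]) ∧
        lam Θ' = (cyclotomicOmegaPlus 3 1).natDegree + 1) ∨
      (ε = 1 ∧
        iwasawaToPowerSeries 3 Θ = ((mazurTateElement f₀ 3 2).map (algebraMap ℚ ℚ_[3]) : PowerSeries ℚ_[3]) ∧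
        lam Θ = (cyclotomicOmegaMinus 3 2).natDegree + 3 ∧
        iwasawaToPowerSeries 3 Θ' = ((mazurTateElement f₀' 3 2).map (algebraMap ℚ ℚ_[3]) : PowerSeries ℚ_[3]) ∧
        lam Θ' = (cyclotomicOmegaMinus 3 2).natDegree + 1)) :
    KobayashiMainConjecture W 3 ε := by
  have hI : integralModelInt W = ⟨1, -1, 1, 341, 113339⟩ :=
    integralModelInt_eq_of_map_eq _ (by rw [hW]; ext <;> simp [WeierstrassCurve.map])
  have hI' : integralModelInt A = ⟨0, 0, 1, -860, 9707⟩ :=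
    integralModelInt_eq_of_map_eq _ (by rw [hA]; ext <;> simp [WeierstrassCurve.map])
  have hp2 : (3 : ℕ) ≠ 2 := by decide
  have hSS : GoodSS W 3 := goodSS_of_intModel 3 hI (by decide) card_lam25_380894f1_3 (by norm_num)
  have hap : W.frobeniusTrace 3 = 0 := by rw [frobeniusTrace_eq hI card_lam25_380894f1_3]; norm_num
  have hSS' : GoodSS A 3 := goodSS_of_intModel 3 hI' (by decide) Summit.BirchSwinnertonDyer.Rank1Residual.X12.Records.card_1849a1_mod3 (by norm_num)
  have hap' : A.frobeniusTrace 3 = 0 := by rw [frobeniusTrace_eq hI' Summit.BirchSwinnertonDyer.Rank1Residual.X12.Records.card_1849a1_mod3]; norm_num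
  have hcm' : A.HasCM := Summit.BirchSwinnertonDyer.BirchSwinnertonDyer.Theorems.hasCM_cm25A_cmm43_tw1_p3 hI'
  have hc4 : W.c₄ = (-16383 : ℚ) := by
    subst hW; norm_num [WeierstrassCurve.c₄, WeierstrassCurve.b₂, WeierstrassCurve.b₄]
  have hc6 : W.c₆ = (-97998849 : ℚ) := by
    subst hW; norm_num [WeierstrassCurve.c₆, WeierstrassCurve.b₂, WeierstrassCurve.b₄, WeierstrassCurve.b₆]
  have hc4A : A.c₄ = (41280 : ℚ) := by
    subst hA; norm_num [WeierstrassCurve.c₄, WeierstrassCurve.b₂, WeierstrassCurve.b₄]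
  have hc6A : A.c₆ = (-8387064 : ℚ) := by
    subst hA; norm_num [WeierstrassCurve.c₆, WeierstrassCurve.b₂, WeierstrassCurve.b₄, WeierstrassCurve.b₆]
  -- the 3-congruence `E[3] ≃ A[3]` as a THEOREM (Fisher's pencil of `A` through `E`), kernel-checked
  have he := threeCongruent_of_hesseCertificate_unconditional A W (208 : ℚ) (1 : ℚ) (4 : ℚ)
    (by norm_num) (by rw [hc4A, hc6A, hc4, eval_hesseC4three]; norm_num)
    (by rw [hc4A, hc6A, hc6, eval_hesseC6three]; norm_num)
  obtain ⟨S₀, hS₀, hS₀W, hS₀A, hsumW, hsumA⟩ := places_380894f1_3 W A hW hA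
  rcases hrow with ⟨rfl, hΘ, hlam, hΘ', hlam'⟩ | ⟨rfl, hΘ, hlam, hΘ', hlam'⟩
  · exact kobayashiMainConjecture_neg_one_of_cmPartner_of_mazurTate h12 h41 h5 h3 h09 hKim hPR hmod hp2 hSS.1
      hap hf₀ (by decide) hΘ hΘ0 hμ hlam hPollack hcm' hSS' hap' he hf₀' (by decide) hΘ' hΘ'0 hμ' hlam' S₀
      hS₀ hS₀W hS₀A (by rw [hsumW, hsumA])
  · exact kobayashiMainConjecture_one_of_cmPartner_of_mazurTate h12 h41 h5 h3 h09 hKim hPR hmod hp2 hSS.1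
      hap hf₀ (by decide) hΘ hΘ0 hμ hlam hPollack hcm' hSS' hap' he hf₀' (by decide) hΘ' hΘ'0 hμ' hlam' S₀
      hS₀ hS₀W hS₀A (by rw [hsumW, hsumA])

/-- **Item 4's statement AT THE PAIR `380894f1 @ 3`**: `∃ ε, KobayashiMainConjecture W 3 ε`, from `lam4_kobayashiMainConjecture_380894f1_3` with
the `ε = -1` rows. PER PAIR; the crux is untouched; nothing booked. [cite: Kobayashi2003, Conjecture (p. 2) and Thm. 4.1] [cite: BDKim2009, Cor. 2.13 (p. 187)]
[cite: Cremona2006, Table 1 (Cremona label 380894f1)] -/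
theorem lam4_exists_kobayashiMainConjecture_380894f1_3
    (h12 : Kobayashi2003.thm12_signedSelmerDual_finite_torsion)
    (h41 : Kobayashi2003.thm41_signedCharIdeal_divisibility)
    (h5 : realPeriodRat_eq_unit_mul_plusPeriod) (h3 : realPeriodRat_eq_unit_mul_plusPeriod_three)
    (h09 : cor213_signedMu_eq_zero_iff_of_torsionIso)
    (hKim : BDKim2009.cor213_signedLambda_add_sum_delta_eq_of_torsionIso)
    (hPR : PollackRubin2004.mainTheorem_signedCharIdeal_eq_of_cm)
    (hmod : nonempty_modularParametrizationData)
    (W A : WeierstrassCurve ℚ) [W.IsElliptic] [W.IsGloballyMinimal] [A.IsElliptic] [A.IsGloballyMinimal]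
    [Fact (Nat.Prime 3)] (hW : W = ⟨1, -1, 1, 341, 113339⟩) (hA : A = ⟨0, 0, 1, -860, 9707⟩)
    (hPollack : ∀ {N : ℕ} [NeZero N] {f : CuspForm (Gamma0 N) 2},
      pollack_exists_plusMinusPAdicLFunction (W := A) (f := f) (p := 3))
    [NeZero (W.conductorNorm ℤ)] {f₀ : CuspForm (Gamma0 (W.conductorNorm ℤ)) 2} (hf₀ : IsNewformOf W f₀)
    [NeZero (A.conductorNorm ℤ)] {f₀' : CuspForm (Gamma0 (A.conductorNorm ℤ)) 2} (hf₀' : IsNewformOf A f₀')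
    {Θ Θ' : IwasawaAlgebra 3}
    (hΘ : iwasawaToPowerSeries 3 Θ = ((mazurTateElement f₀ 3 3).map (algebraMap ℚ ℚ_[3]) : PowerSeries ℚ_[3]))
    (hΘ0 : Θ ≠ 0) (hμ : mu Θ = 0) (hlam : lam Θ = (cyclotomicOmegaPlus 3 3).natDegree + 3)
    (hΘ' : iwasawaToPowerSeries 3 Θ' = ((mazurTateElement f₀' 3 1).map (algebraMap ℚ ℚ_[3]) : PowerSeries ℚ_[3]))
    (hΘ'0 : Θ' ≠ 0) (hμ' : mu Θ' = 0) (hlam' : lam Θ' = (cyclotomicOmegaPlus 3 1).natDegree + 1) :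
    ∃ ε : ℤˣ, KobayashiMainConjecture W 3 ε :=
  ⟨-1, lam4_kobayashiMainConjecture_380894f1_3 h12 h41 h5 h3 h09 hKim hPR hmod W A hW hA hPollack hf₀ hf₀'
    (-1) hΘ0 hμ hΘ'0 hμ' (Or.inl ⟨rfl, hΘ, hlam, hΘ', hlam'⟩)⟩


end Summit.BirchSwinnertonDyer.BirchSwinnertonDyer.Theorems.SmallImageCongruenceRoad

end
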